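import Summits.KontsevichZagierPeriods.Zeta5Search.Barrier.ConeGammaCuspTransport

/-!
# ζ(5) search — BARRIER: THE KINK ACROSS A COINCIDENCE WALL IS THE LOCAL MODULARITY DEFECT

HONEST FRAMING (cell `pub-zeta5`): systematic search; no irrationality claim unless kernel-certified. MODEL objects
under Brown–Zudilin's (28)+(30) accounting ([BZ22] = arXiv:2210.03391; (28) observed, not proved); nothing here is a
statement about `ζ(5)`, any `γ` of record, the cone's supremum (C2 OPEN) or the value / sign of any vote, weight or
defect at a named direction (DATA of the cell); S-E stays CONJECTURED; records in print UNMOVED. Prover P2 g30, item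
«THE JUNCTION VOTE IS A LOVÁSZ EXTENSION» (INBOX 2026-08-27), file (6), sequel of `ConeGammaCuspGermLovasz`.

Two generic reference orders on the member finset `M` that differ by ONE ADJACENT TRANSPOSITION — `k` just before `l`
in `ρ`, `l` just before `k` in `ρ'`, the same members `S` before the pair in both — have greedy functionals differing
by the LOCAL MODULARITY DEFECT times the splitting:
* `greedy_sub_greedy_of_prefix` (prefix-set form), **`greedy_sub_greedy_of_adjacent`** (order form):
  `G_{ρ'}(x) − G_ρ(x) = m·(x_l − x_k)`, **`m = f(S ∪ {k}) + f(S ∪ {l}) − f(S) − f(S ∪ {k,l})`**;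
* **`germ_pair_eq_greedy_add_defect`** — at a junction, for `δ` in the closed chamber of the swapped order `δ₀'`:
  `K_b(δ) = Σ_{j∈M} w_j(δ₀)·φ_j(δ)/h_j(a) + m_b·(φ_l(δ)/h_l − φ_k(δ)/h_k)`: ACROSS THE WALL `φ_k/h_k = φ_l/h_l` the vote is
  the old chamber functional plus the defect times the splitting — the wall is a kink of `K_b` iff `m_b ≠ 0`, a convex
  kink iff `m_b > 0` (locally submodular step), concave iff `m_b < 0`; with two walls and `S = ∅`,
  `m_b = f{k} + f{l} − f∅ − f{k,l}` is RIDER 5's two-wall defect. This is the kernel reason for P2 g29's kink census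
  (DATA: 60 kinks and 54 FLAT walls among 114 coincidence walls — flat = locally modular step) and for «modular
  junctions never kink» (`germ_pair_eq_linear_of_modular`).
NOT here: the defect of any named wall; `γ`, C2, S-E, `ζ(5)`.
-/

noncomputable section

open Set MeasureTheory Finset
open scoped Topology

namespace Summit.KontsevichZagierPeriods.Zeta5Search.Barrier.ConeGamma

/-! ### Adjacent transposition of a reference order: the greedy functionals differ by the local defect -/

/-- **Prefix-set form.** If the prefix sets of `ρ` and `ρ'` agree for every member other than `k, l`, and at `k, l`
are those of «`S`, then `k`, then `l`» resp. «`S`, then `l`, then `k`», the greedy functionals differ by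
`(f(S∪{k}) + f(S∪{l}) − f(S) − f(S∪{k,l}))·(x_l − x_k)`. -/
theorem greedy_sub_greedy_of_prefix {M : Finset (Fin 28)} (f : Finset (Fin 28) → ℝ) {ρ ρ' : Fin 28 → ℝ}
    {S : Finset (Fin 28)} {k l : Fin 28} (hk : k ∈ M) (hl : l ∈ M) (hkl : k ≠ l)
    (hk1 : M.filter (fun j => ρ k < ρ j) = S) (hk2 : M.filter (fun j => ρ k ≤ ρ j) = insert k S)
    (hl1 : M.filter (fun j => ρ l < ρ j) = insert k S)
    (hl2 : M.filter (fun j => ρ l ≤ ρ j) = insert l (insert k S))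
    (hl1' : M.filter (fun j => ρ' l < ρ' j) = S) (hl2' : M.filter (fun j => ρ' l ≤ ρ' j) = insert l S)
    (hk1' : M.filter (fun j => ρ' k < ρ' j) = insert l S)
    (hk2' : M.filter (fun j => ρ' k ≤ ρ' j) = insert k (insert l S))
    (hother : ∀ j ∈ M, j ≠ k → j ≠ l →
      M.filter (fun i => ρ' j < ρ' i) = M.filter (fun i => ρ j < ρ i) ∧
        M.filter (fun i => ρ' j ≤ ρ' i) = M.filter (fun i => ρ j ≤ ρ i))
    (x : Fin 28 → ℝ) :
    ∑ j ∈ M, (f (M.filter fun i => ρ' j ≤ ρ' i) - f (M.filter fun i => ρ' j < ρ' i)) * x j -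
        ∑ j ∈ M, (f (M.filter fun i => ρ j ≤ ρ i) - f (M.filter fun i => ρ j < ρ i)) * x j =
      (f (insert k S) + f (insert l S) - f S - f (insert k (insert l S))) * (x l - x k) := by
  classical
  rw [← Finset.sum_sub_distrib, Finset.sum_eq_add_of_mem k l hk hl hkl fun j hj hne => by
    rw [(hother j hj hne.1 hne.2).1, (hother j hj hne.1 hne.2).2, sub_self]]
  rw [hk1, hk2, hl1, hl2, hl1', hl2', hk1', hk2', Finset.insert_comm l k S]
  ring

/-- **ORDER FORM — ONE ADJACENT TRANSPOSITION.** Let `ρ, ρ'` be pairwise distinct on `M`, `k ≠ l` members with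
`ρ l < ρ k` (`k` flips first for `ρ`), `ρ' k < ρ' l` (`l` first for `ρ'`), no member strictly between them for `ρ`,
every other member on the same side of the pair for both, and the same relative order among the other members. Then
`G_{ρ'}(x) − G_ρ(x) = (f(S∪{k}) + f(S∪{l}) − f(S) − f(S∪{k,l}))·(x_l − x_k)` with `S = {j ∈ M : ρ k < ρ j}` the members
before the pair — the greedy functional jumps by the LOCAL MODULARITY DEFECT times the splitting. -/
theorem greedy_sub_greedy_of_adjacent {M : Finset (Fin 28)} (f : Finset (Fin 28) → ℝ) {ρ ρ' : Fin 28 → ℝ}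
    (hgen : ∀ i ∈ M, ∀ j ∈ M, i ≠ j → ρ i ≠ ρ j) (hgen' : ∀ i ∈ M, ∀ j ∈ M, i ≠ j → ρ' i ≠ ρ' j)
    {k l : Fin 28} (hk : k ∈ M) (hl : l ∈ M) (hkl : k ≠ l) (hρ : ρ l < ρ k) (hρ' : ρ' k < ρ' l)
    (hadj : ∀ j ∈ M, ¬(ρ l < ρ j ∧ ρ j < ρ k))
    (hside : ∀ j ∈ M, j ≠ k → j ≠ l → (ρ k < ρ j ↔ ρ' k < ρ' j) ∧ (ρ l < ρ j ↔ ρ' l < ρ' j))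
    (hsame : ∀ i ∈ M, ∀ j ∈ M, i ≠ k → i ≠ l → j ≠ k → j ≠ l → (ρ i < ρ j ↔ ρ' i < ρ' j))
    (x : Fin 28 → ℝ) :
    ∑ j ∈ M, (f (M.filter fun i => ρ' j ≤ ρ' i) - f (M.filter fun i => ρ' j < ρ' i)) * x j -
        ∑ j ∈ M, (f (M.filter fun i => ρ j ≤ ρ i) - f (M.filter fun i => ρ j < ρ i)) * x j =
      (f (insert k (M.filter fun j => ρ k < ρ j)) + f (insert l (M.filter fun j => ρ k < ρ j)) -
          f (M.filter fun j => ρ k < ρ j) - f (insert k (insert l (M.filter fun j => ρ k < ρ j)))) *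
        (x l - x k) := by
  classical
  -- the prefix sets at `k` and `l`
  have hk2 := (prefix_le_eq_insert hgen hk).1
  have hl1 : M.filter (fun j => ρ l < ρ j) = insert k (M.filter fun j => ρ k < ρ j) := by
    ext j
    simp only [Finset.mem_filter, Finset.mem_insert]
    constructor
    · rintro ⟨hj, hlj⟩
      by_cases hjk : j = k
      · exact Or.inl hjk
      · exact Or.inr ⟨hj, lt_of_le_of_ne (not_lt.mp fun h => hadj j hj ⟨hlj, h⟩) (hgen k hk j hj (Ne.symm hjk))⟩
    · rintro (rfl | ⟨hj, hkj⟩)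
      · exact ⟨hk, hρ⟩
      · exact ⟨hj, hρ.trans hkj⟩
  have hl2 : M.filter (fun j => ρ l ≤ ρ j) = insert l (insert k (M.filter fun j => ρ k < ρ j)) := by
    rw [(prefix_le_eq_insert hgen hl).1, hl1]
  have hl1' : M.filter (fun j => ρ' l < ρ' j) = M.filter (fun j => ρ k < ρ j) := by
    ext j
    simp only [Finset.mem_filter, and_congr_right_iff]
    intro hj
    by_cases hjk : j = k
    · subst hjk; exact ⟨fun h => absurd h (not_lt.mpr hρ'.le), fun h => absurd h (lt_irrefl _)⟩
    by_cases hjl : j = l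
    · subst hjl; exact ⟨fun h => absurd h (lt_irrefl _), fun h => absurd (hρ.trans h) (lt_irrefl _)⟩
    rw [← (hside j hj hjk hjl).2]
    constructor
    · intro h; exact lt_of_le_of_ne (not_lt.mp fun h' => hadj j hj ⟨h, h'⟩) (hgen k hk j hj (Ne.symm hjk))
    · intro h; exact hρ.trans h
  have hl2' : M.filter (fun j => ρ' l ≤ ρ' j) = insert l (M.filter fun j => ρ k < ρ j) := by
    rw [(prefix_le_eq_insert hgen' hl).1, hl1']
  have hk1' : M.filter (fun j => ρ' k < ρ' j) = insert l (M.filter fun j => ρ k < ρ j) := by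
    ext j
    simp only [Finset.mem_filter, Finset.mem_insert]
    constructor
    · rintro ⟨hj, hkj⟩
      by_cases hjl : j = l
      · exact Or.inl hjl
      · have hjk : j ≠ k := fun h => by subst h; exact lt_irrefl _ hkj
        exact Or.inr ⟨hj, (hside j hj hjk hjl).1.mpr hkj⟩
    · rintro (rfl | ⟨hj, hkj⟩)
      · exact ⟨hl, hρ'⟩
      · have hjk : j ≠ k := fun h => by subst h; exact lt_irrefl _ hkj
        have hjl : j ≠ l := fun h => by subst h; exact absurd (hρ.trans hkj) (lt_irrefl _)
        exact ⟨hj, (hside j hj hjk hjl).1.mp hkj⟩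
  have hk2' : M.filter (fun j => ρ' k ≤ ρ' j) = insert k (insert l (M.filter fun j => ρ k < ρ j)) := by
    rw [(prefix_le_eq_insert hgen' hk).1, hk1']
  -- the other members keep their prefix sets
  have hother : ∀ j ∈ M, j ≠ k → j ≠ l →
      M.filter (fun i => ρ' j < ρ' i) = M.filter (fun i => ρ j < ρ i) ∧
        M.filter (fun i => ρ' j ≤ ρ' i) = M.filter (fun i => ρ j ≤ ρ i) := by
    intro j hj hjk hjl
    have hlt : ∀ i ∈ M, (ρ' j < ρ' i ↔ ρ j < ρ i) := by
      intro i hi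
      by_cases hik : i = k
      · rw [hik]
        have e1 : ρ' j < ρ' k ↔ ¬(ρ' k < ρ' j) :=
          ⟨fun h h' => lt_asymm h h', fun h => lt_of_le_of_ne (not_lt.mp h) (hgen' j hj k hk hjk)⟩
        have e2 : ρ j < ρ k ↔ ¬(ρ k < ρ j) :=
          ⟨fun h h' => lt_asymm h h', fun h => lt_of_le_of_ne (not_lt.mp h) (hgen j hj k hk hjk)⟩
        rw [e1, e2, (hside j hj hjk hjl).1]
      by_cases hil : i = l
      · rw [hil]
        have e1 : ρ' j < ρ' l ↔ ¬(ρ' l < ρ' j) :=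
          ⟨fun h h' => lt_asymm h h', fun h => lt_of_le_of_ne (not_lt.mp h) (hgen' j hj l hl hjl)⟩
        have e2 : ρ j < ρ l ↔ ¬(ρ l < ρ j) :=
          ⟨fun h h' => lt_asymm h h', fun h => lt_of_le_of_ne (not_lt.mp h) (hgen j hj l hl hjl)⟩
        rw [e1, e2, (hside j hj hjk hjl).2]
      exact (hsame j hj i hi hjk hjl hik hil).symm
    refine ⟨Finset.filter_congr fun i hi => hlt i hi, Finset.filter_congr fun i hi => ?_⟩
    by_cases hij : i = j
    · subst hij; simp
    · rw [(hgen' j hj i hi (Ne.symm hij)).le_iff_lt, (hgen j hj i hi (Ne.symm hij)).le_iff_lt]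
      exact hlt i hi
  exact greedy_sub_greedy_of_prefix f hk hl hkl rfl hk2 hl1 hl2 hl1' hl2' hk1' hk2' hother x

/-! ### Across the wall: the vote is the old chamber functional plus the defect times the splitting -/

/-- **THE KINK ACROSS A COINCIDENCE WALL IS THE LOCAL MODULARITY DEFECT.** Junction `b ∈ bkpts a T` (all forms of
`a` positive), finset `M`, pattern function `f` through which the saving factors near `θ_b`. Let `δ₀, δ₀'` be generic
on `M` with member flip orders differing by ONE adjacent transposition of `k, l ∈ M` (`k` first for `δ₀`, `l` first for
`δ₀'`; hypotheses as in `greedy_sub_greedy_of_adjacent` on the rates `φ_j(δ₀)/h_j`, `φ_j(δ₀')/h_j`). Then for every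
`δ` refined by `δ₀'` on `M` and every admissible `η`:
`germR(δ)(b) + germL(δ)(b) = Σ_{j∈M} w_j(δ₀)·φ_j(δ)/h_j(a) + m_b·(φ_l(δ)/h_l − φ_k(δ)/h_k)`, `w_j(δ₀)` the greedy weights
of `δ₀` and `m_b = f(S∪{k}) + f(S∪{l}) − f(S) − f(S∪{k,l})`, `S = {j ∈ M : φ_k(δ₀)/h_k < φ_j(δ₀)/h_j}`: the wall
`φ_k/h_k = φ_l/h_l` between the two chambers is a kink of the vote iff `m_b ≠ 0`. -/
theorem germ_pair_eq_greedy_add_defect {a : Dir} (hpos : ∀ k, 0 < h28 a k) {T b : ℝ} (hb : b ∈ bkpts a T)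
    {M : Finset (Fin 28)} {f : Finset (Fin 28) → ℝ}
    (hf : ∀ Δ : Fin 8 → ℝ, (∀ k, |phiForm Δ k| < 1) → (∀ k, |phiForm Δ k| < wallDist a T) →
      (torusN (b • sParam a + Δ) : ℝ) = f (M.filter fun k => 0 ≤ phiForm Δ k))
    {δ₀ δ₀' : Fin 8 → ℝ}
    (hgen : ∀ i ∈ M, ∀ j ∈ M, i ≠ j → phiForm δ₀ i / h28 a i ≠ phiForm δ₀ j / h28 a j)
    (hgen' : ∀ i ∈ M, ∀ j ∈ M, i ≠ j → phiForm δ₀' i / h28 a i ≠ phiForm δ₀' j / h28 a j)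
    {k l : Fin 28} (hk : k ∈ M) (hl : l ∈ M) (hkl : k ≠ l)
    (hρ : phiForm δ₀ l / h28 a l < phiForm δ₀ k / h28 a k)
    (hρ' : phiForm δ₀' k / h28 a k < phiForm δ₀' l / h28 a l)
    (hadj : ∀ j ∈ M, ¬(phiForm δ₀ l / h28 a l < phiForm δ₀ j / h28 a j ∧
      phiForm δ₀ j / h28 a j < phiForm δ₀ k / h28 a k))
    (hside : ∀ j ∈ M, j ≠ k → j ≠ l →
      (phiForm δ₀ k / h28 a k < phiForm δ₀ j / h28 a j ↔ phiForm δ₀' k / h28 a k < phiForm δ₀' j / h28 a j) ∧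
      (phiForm δ₀ l / h28 a l < phiForm δ₀ j / h28 a j ↔ phiForm δ₀' l / h28 a l < phiForm δ₀' j / h28 a j))
    (hsame : ∀ i ∈ M, ∀ j ∈ M, i ≠ k → i ≠ l → j ≠ k → j ≠ l →
      (phiForm δ₀ i / h28 a i < phiForm δ₀ j / h28 a j ↔ phiForm δ₀' i / h28 a i < phiForm δ₀' j / h28 a j))
    (δ : Fin 8 → ℝ) (href : ∀ i ∈ M, ∀ j ∈ M, phiForm δ i / h28 a i < phiForm δ j / h28 a j →
      phiForm δ₀' i / h28 a i < phiForm δ₀' j / h28 a j)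
    {η : ℝ} (hη : 0 < η) (h1 : η * clusterBound a δ < 1) (h2 : η * clusterBound a δ < wallDist a T) :
    germR a δ η b + germL a δ η b =
      ∑ j ∈ M, (f (M.filter fun i => phiForm δ₀ j / h28 a j ≤ phiForm δ₀ i / h28 a i) -
          f (M.filter fun i => phiForm δ₀ j / h28 a j < phiForm δ₀ i / h28 a i)) * (phiForm δ j / h28 a j) +
        (f (insert k (M.filter fun j => phiForm δ₀ k / h28 a k < phiForm δ₀ j / h28 a j)) +
            f (insert l (M.filter fun j => phiForm δ₀ k / h28 a k < phiForm δ₀ j / h28 a j)) -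
            f (M.filter fun j => phiForm δ₀ k / h28 a k < phiForm δ₀ j / h28 a j) -
            f (insert k (insert l (M.filter fun j => phiForm δ₀ k / h28 a k < phiForm δ₀ j / h28 a j)))) *
          (phiForm δ l / h28 a l - phiForm δ k / h28 a k) := by
  rw [germ_pair_eq_greedy_of_refines hpos hb hf hgen' δ href hη h1 h2]
  have h := greedy_sub_greedy_of_adjacent (M := M) f (ρ := fun j => phiForm δ₀ j / h28 a j)
    (ρ' := fun j => phiForm δ₀' j / h28 a j) hgen hgen' hk hl hkl hρ hρ' hadj hside hsame
    (fun j => phiForm δ j / h28 a j)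
  linarith

end Summit.KontsevichZagierPeriods.Zeta5Search.Barrier.ConeGamma

end
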